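import Literature.Computability.Cryptography.RegevDGSReduction
import HarnessLib

/-!
# Regev's quantum reduction, II: Thm 3.1 with the worst-case oracle and the average-case bridge

Companion of `RegevDGSReduction.lean` (assembly of pqc.S19 `regev_lwe_to_sivp_quantum` from
Regev 2009, Thm 3.1 and Lemma 3.17). There the hypothesis `hB` is Thm 3.1 in the hypothesis
format of pqc.S19: ONE poly-time uniform quantum family solving search-`LWE_{q,Ψ̄_α}` with
AVERAGE-case success probability `≥ 2/3`. Regev's own notion "an algorithm solves `LWE_{p,χ}`"
(§2, p. 12, "Learning with errors") is WORST-case: for EVERY secret `s`, given samples from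
`A_{s,χ}` it outputs `s` with probability exponentially close to `1`. A faithful vendoring of
Thm 3.1 as a named fact must use that notion, with the (standard) average-case-to-worst-case
amplification recorded as a separate step. This file provides

* the predicate `UniformQCircuitFamily.SolvesSearchLWEWorstCase W q χ m δ` (for all large `n` and
  every secret, success probability `≥ 1 - δ n` on `m n` samples; Regev: `δ = 2^{-Ω(n)}`), with
  the sanity link `SolvesSearchLWEWorstCase.searchLWESolves` (worst case implies average case);
* the PROVED conditional assembly `regev_lwe_to_sivp_quantum_of_worstCase h₁ h₂ h₃`, whose
  hypotheses are: `h₁` the average-case bridge, `h₂` Thm 3.1 AS PRINTED (with Lemma 4.3 for the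
  discretised oracle, i.e. the hypothesis form of the informal Thm 1.1), `h₃` Lemma 3.17; it
  composes `h₁`, `h₂` into `hB` and calls `regev_lwe_to_sivp_quantum_of_dgs`.

No named fact is introduced (the three hypotheses are the intended children of a split of
pqc.S19; each is a distinct statement with its own locator in Regev 2009).

## Faithfulness notes

* `h₁` (bridge). Tools all from the paper: the shift `(a,b) ↦ (a, b + ⟨a,t⟩)` (proof of
  Lemma 4.1) maps `A_{s,χ}` to `A_{s+t,χ}` with `s + t` uniform, so one call of the average-case
  solver succeeds with probability `≥ 2/3` on EVERY secret; `n` independent repetitions (fresh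
  samples, fresh shifts) and the verification test of Lemma 3.6 (which, for `α < 1` and
  `p → ∞`, accepts the true secret and rejects every wrong candidate with probability exponentially
  close to `1`, also on discretised samples) give failure probability `2^{-Ω(n)}` with
  `m'(n) = n·m(n) + n²` samples, a polynomial that is poly-time computable when `m` is
  (`IsPolyTimeParams q α m'`).
* `h₂` is Thm 3.1 with: `p = q(n)` any integer modulus of polynomially many bits (implicit in
  `IsPolyTimeParams`; Regev: "p can be an arbitrary integer", §2 p. 12), a polynomial number
  `m'(n)` of samples, the oracle a poly-time uniform quantum family (Thm 1.1: "an efficient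
  algorithm"; the reduction uses it as a black box), `Ψ̄_α` instead of `Ψ_α` (Lemma 4.3), and the
  conclusion up to a negligible statistical distance (`SamplesDGS`, §2 p. 11).

## References

* O. Regev, *On lattices, learning with errors, random linear codes, and cryptography*, J. ACM 56
  (2009), art. 34 (arXiv:2401.03703): §2 p. 11–12, Thm 1.1, Thm 3.1, Lemmas 3.6, 3.7, 3.17, 4.1,
  4.3.
-/

noncomputable section

open Filter Asymptotics Literature.Computability.Complexity Literature.Computability.Cryptography.LWE
  Literature.Algebra.EuclideanLattices
open scoped ENNReal

namespace Literature.Computability.Cryptography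

namespace UniformQCircuitFamily

/-- `W.SolvesSearchLWEWorstCase q χ m δ`: the poly-time uniform quantum family `W` *solves
search-`LWE_{q(n),χ(n)}` in the worst case over the secret, up to failure probability `δ`*: for all
large `n` and EVERY secret `s ∈ ℤ_qⁿ`, fed (the code of) `m n` samples of `A_{s,χ}`, it outputs
`s` with probability `≥ 1 - δ n` (`searchSuccessProbOf`, the per-secret success probability).
This is Regev's notion "an algorithm solves `LWE_{p,χ}`" (§2, p. 12: for any `s`, given samples
from `A_{s,χ}`, it outputs `s` with probability exponentially close to `1`, i.e. `δ n = 2^{-Ω(n)}`),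
for a fixed polynomial number `m n` of samples. [cite: Regev2009, §2 (Learning with errors, p. 12)] -/
def SolvesSearchLWEWorstCase (W : UniformQCircuitFamily) (q : ℕ → ℕ) [∀ n, NeZero (q n)]
    (χ : ∀ n, PMF (ZMod (q n))) (m : ℕ → ℕ) (δ : ℕ → ℝ) : Prop :=
  ∀ᶠ n in atTop, ∀ s : Fin n → ZMod (q n),
    ENNReal.ofReal (1 - δ n) ≤ searchSuccessProbOf (χ n) (m n) (W.searchLWESolver n (q n) (m n)) s

/-- Unfolding of `SolvesSearchLWEWorstCase`. [folklore] -/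
theorem solvesSearchLWEWorstCase_iff (W : UniformQCircuitFamily) (q : ℕ → ℕ) [∀ n, NeZero (q n)]
    (χ : ∀ n, PMF (ZMod (q n))) (m : ℕ → ℕ) (δ : ℕ → ℝ) :
    W.SolvesSearchLWEWorstCase q χ m δ ↔ ∀ᶠ n in atTop, ∀ s : Fin n → ZMod (q n),
      ENNReal.ofReal (1 - δ n) ≤
        searchSuccessProbOf (χ n) (m n) (W.searchLWESolver n (q n) (m n)) s :=
  Iff.rfl

/-- Monotonicity in the failure bound: a solver with failure `≤ δ` is one with failure `≤ δ'` for
any eventually larger `δ'`. [folklore] -/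
theorem SolvesSearchLWEWorstCase.mono {W : UniformQCircuitFamily} {q : ℕ → ℕ} [∀ n, NeZero (q n)]
    {χ : ∀ n, PMF (ZMod (q n))} {m : ℕ → ℕ} {δ δ' : ℕ → ℝ}
    (h : W.SolvesSearchLWEWorstCase q χ m δ) (hδ : ∀ᶠ n in atTop, δ n ≤ δ' n) :
    W.SolvesSearchLWEWorstCase q χ m δ' := by
  filter_upwards [h, hδ] with n hn hδn s
  exact (ENNReal.ofReal_le_ofReal (by linarith)).trans (hn s)

/-- A worst-case solver is an average-case solver with the same threshold: averaging the
per-secret bound over the uniform secret (`searchSuccessProb` is the uniform average of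
`searchSuccessProbOf`). [Regev 2009, §4 (Lemma 4.1, the easy direction)] [folklore] -/
theorem SolvesSearchLWEWorstCase.searchLWESolves {W : UniformQCircuitFamily} {q : ℕ → ℕ}
    [∀ n, NeZero (q n)] {χ : ∀ n, PMF (ZMod (q n))} {m : ℕ → ℕ} {δ : ℕ → ℝ}
    (h : W.SolvesSearchLWEWorstCase q χ m δ) :
    SearchLWESolves q χ m (fun n => W.searchLWESolver n (q n) (m n)) fun n => 1 - δ n := by
  filter_upwards [h] with n hn
  change ENNReal.ofReal (1 - δ n) ≤ ∑ s, PMF.uniformOfFintype (Fin n → ZMod (q n)) s *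
    searchSuccessProbOf (χ n) (m n) (W.searchLWESolver n (q n) (m n)) s
  calc ENNReal.ofReal (1 - δ n)
      = ∑ s : Fin n → ZMod (q n), PMF.uniformOfFintype (Fin n → ZMod (q n)) s *
          ENNReal.ofReal (1 - δ n) := by
        rw [← Finset.sum_mul]
        simp only [PMF.uniformOfFintype_apply, Finset.sum_const, Finset.card_univ, nsmul_eq_mul]
        rw [ENNReal.mul_inv_cancel (by exact_mod_cast Fintype.card_ne_zero) (ENNReal.natCast_ne_top _),
          one_mul]
    _ ≤ ∑ s : Fin n → ZMod (q n), PMF.uniformOfFintype (Fin n → ZMod (q n)) s *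
          searchSuccessProbOf (χ n) (m n) (W.searchLWESolver n (q n) (m n)) s :=
        Finset.sum_le_sum fun s _ => by gcongr; exact hn s

end UniformQCircuitFamily

section WorstCase

variable (q : ℕ → ℕ) [∀ n, NeZero (q n)] (α : ℕ → ℝ) (m : ℕ → ℕ)

/-- **Assembly of pqc.S19 with Thm 3.1 in Regev's worst-case form.** Same as
`regev_lwe_to_sivp_quantum_of_dgs`, with its hypothesis `hB` split — as a faithful vendoring of
the printed results requires — into

* `h₁` — the AVERAGE-CASE BRIDGE: one poly-time uniform quantum family solving
  search-`LWE_{q,Ψ̄_α}` on `m(n)` samples with average-case success `≥ 2/3` (for all large `n`)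
  yields one solving it for EVERY secret with probability exponentially close to `1`
  (`SolvesSearchLWEWorstCase … (2^{-cn})`, some `c > 0`) on some polynomially bounded, poly-time
  computable number `m'(n)` of samples (shift `(a,b) ↦ (a,b+⟨a,t⟩)` of the proof of Lemma 4.1,
  `n`-fold repetition, verification by Lemma 3.6);
* `h₂` — **Thm 3.1 as printed** (with Lemma 4.3 for the discretised oracle — the hypothesis form
  of the informal Thm 1.1, "an efficient algorithm that solves `LWE_{p,Ψ̄_α}`"): `p = p(n)` an
  integer, `α(n) ∈ (0,1)`, `αp > 2√n` (for all large `n`), an oracle solving `LWE_{p,Ψ̄_α}` for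
  every secret with probability exponentially close to `1` from a polynomial number `m'(n)` of
  samples, and the implicit uniformity `IsPolyTimeParams q α m'` ⟹ for every negligible `ε > 0`,
  an efficient quantum sampler for `DGS_{√(2n)·η_ε(L)/α}` up to a negligible statistical distance
  (`SamplesDGS (regevDGSBound α ε)`);
* `h₃` — **Lemma 3.17**, exactly the hypothesis `hC` of `regev_lwe_to_sivp_quantum_of_dgs`.

The proof composes `h₁` and `h₂` into `hB` and calls `regev_lwe_to_sivp_quantum_of_dgs`.
[cite: Regev2009, Thm 3.1 (with §2 p. 12, Lemmas 3.6, 4.1, 4.3) and Lemma 3.17] -/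
theorem regev_lwe_to_sivp_quantum_of_worstCase
    (h₁ : ∀ (_ : IsPolyBounded m) (_ : IsPolyTimeParams q α m)
      (_ : ∀ᶠ n : ℕ in atTop, 0 < α n ∧ α n < 1 ∧ 2 * Real.sqrt n < α n * q n)
      (_ : ∃ Q : UniformQCircuitFamily, SearchLWESolves q (fun n => discretizedGaussian (q n) (α n))
        m (fun n => Q.searchLWESolver n (q n) (m n)) fun _ => 2 / 3),
      ∃ (W : UniformQCircuitFamily) (m' : ℕ → ℕ) (c : ℝ), IsPolyBounded m' ∧
        IsPolyTimeParams q α m' ∧ 0 < c ∧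
        W.SolvesSearchLWEWorstCase q (fun n => discretizedGaussian (q n) (α n)) m'
          fun n => (2 : ℝ) ^ (-(c * n)))
    (h₂ : ∀ (m' : ℕ → ℕ) (_ : IsPolyBounded m') (_ : IsPolyTimeParams q α m')
      (_ : ∀ᶠ n : ℕ in atTop, 0 < α n ∧ α n < 1 ∧ 2 * Real.sqrt n < α n * q n)
      (_ : ∃ (W : UniformQCircuitFamily) (c : ℝ), 0 < c ∧
        W.SolvesSearchLWEWorstCase q (fun n => discretizedGaussian (q n) (α n)) m'
          fun n => (2 : ℝ) ^ (-(c * n)))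
      (ε : ℕ → ℝ), IsNegligible ε → (∀ n, 0 < ε n) →
      ∃ (D : UniformQCircuitFamily) (ν : ℕ → ℝ), IsNegligible ν ∧ D.SamplesDGS (regevDGSBound α ε) ν)
    (h₃ : ∀ (ε : ℕ → ℝ) (φ : LatticeInstance → ℝ), (∀ n, 0 < ε n ∧ ε n ≤ 1 / 10) →
      (∀ᶠ n in atTop, ∀ I : LatticeInstance, I.n = n → I.IsNonsingular →
        Real.sqrt 2 * smoothingParameter I.lattice (ε n) ≤ φ I) →
      ∀ (D : UniformQCircuitFamily) (ν : ℕ → ℝ), IsNegligible ν → D.SamplesDGS φ ν →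
        ∃ G : UniformQCircuitFamily, G.SolvesGIVP fun I => 2 * Real.sqrt I.n * φ I) :
    regev_lwe_to_sivp_quantum q α m := by
  refine regev_lwe_to_sivp_quantum_of_dgs q α m (fun hm hpar hα hLWE ε hε hε0 => ?_) h₃
  obtain ⟨W, m', c, hm', hpar', hc, hW⟩ := h₁ hm hpar hα hLWE
  exact h₂ m' hm' hpar' hα ⟨W, c, hc, hW⟩ ε hε hε0

end WorstCase

end Literature.Computability.Cryptography

end
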